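import Summits.ValiantsHypothesis.ValiantsHypothesis.Theorems.GrenetZeonDualUnipotentThreeHalvesHeavyTopHalfSpeedDefs

/-!
# `GrenetZeon.DualUnipotentThreeHalves` (stmt-ValiantsHypothesis-24318), LINE β `half_speed`, stub K1 (iii) — LEVEL BOOKKEEPING for
# the assembly: orientation flip and monotone coarsening of block-triangular level functions

Two one-screen facts the K1 assembly (port-2 g2 / port-1 g3, desk #332) needs between ✓ `…CompositionBlocks.exists_block_conj`
(which kills entries with ROW level < COLUMN level) and ✓ `…HalfSpeedLoop.exists_halfSpeed_chain` (which kills entries with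
`lvl j < lvl i`, ROW level > COLUMN level):
* `blockTri_flip` — flipping the levels `lvl ↦ L − 1 − lvl` exchanges the two orientations;
* `blockTri_comp_monotone` / `blockTri_comp_monotone'` — composing the level function with a MONOTONE map `σ` (coarsening levels into
  consecutive groups) preserves block-triangularity, in either orientation.
Honest framing: bookkeeping for a stub of LINE β; nothing here proves `HalfSpeedLaw`, `HalfSpeedIrrLaw`, `HeavyTopLaw`, 24318, S3b or
8062; `VP ≠ VNP` is not moved; no summit statement is proved here.  No definitions, no named facts. [β card K1 (iii); val-port-3 g2]
-/

noncomputable section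

-- single-conjunct layout: Sub = Summit, duplicated namespace component intended
set_option linter.dupNamespace false

namespace Summit.ValiantsHypothesis.ValiantsHypothesis.Theorems.GrenetZeon.HalfSpeed

open Matrix

variable {ι : Type*} {R : Type*}

/-- **Orientation flip.**  If entries with row level `<` column level vanish (the `exists_block_conj` orientation), then for the
flipped levels `L − 1 − lvl` entries with column level `<` row level vanish (the `exists_halfSpeed_chain` orientation). -/
theorem blockTri_flip (lvl : ι → ℕ) (L : ℕ) (hlvl : ∀ i, lvl i < L) (A : Matrix ι ι R) [Zero R]
    (h : ∀ i j, lvl i < lvl j → A i j = 0) :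
    ∀ i j, (L - 1 - lvl j) < (L - 1 - lvl i) → A i j = 0 := by
  intro i j hij
  have hi := hlvl i; have hj := hlvl j
  exact h i j (by omega)

/-- The flip is an involution on levels `< L`. -/
theorem flip_flip (lvl : ι → ℕ) (L : ℕ) (hlvl : ∀ i, lvl i < L) (i : ι) : L - 1 - (L - 1 - lvl i) = lvl i := by
  have := hlvl i; omega

/-- Flipped levels are again `< L` (for `L ≥ 1`, automatic when `ι` is inhabited). -/
theorem flip_lt (lvl : ι → ℕ) (L : ℕ) (hlvl : ∀ i, lvl i < L) (i : ι) : L - 1 - lvl i < L := by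
  have := hlvl i; omega

/-- **Monotone coarsening, loop orientation.**  If `lvl j < lvl i ⇒ A i j = 0` and `σ` is monotone, then
`σ (lvl j) < σ (lvl i) ⇒ A i j = 0` (coarse levels `μ = σ ∘ lvl`). -/
theorem blockTri_comp_monotone (lvl : ι → ℕ) (σ : ℕ → ℕ) (hσ : Monotone σ) (A : Matrix ι ι R) [Zero R]
    (h : ∀ i j, lvl j < lvl i → A i j = 0) :
    ∀ i j, σ (lvl j) < σ (lvl i) → A i j = 0 := by
  intro i j hij
  refine h i j (lt_of_not_ge fun hle => ?_)
  exact absurd (hσ hle) (not_le.mpr hij)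

/-- **Monotone coarsening, `exists_block_conj` orientation.**  If `lvl i < lvl j ⇒ A i j = 0` and `σ` is monotone, then
`σ (lvl i) < σ (lvl j) ⇒ A i j = 0`. -/
theorem blockTri_comp_monotone' (lvl : ι → ℕ) (σ : ℕ → ℕ) (hσ : Monotone σ) (A : Matrix ι ι R) [Zero R]
    (h : ∀ i j, lvl i < lvl j → A i j = 0) :
    ∀ i j, σ (lvl i) < σ (lvl j) → A i j = 0 := by
  intro i j hij
  refine h i j (lt_of_not_ge fun hle => ?_)
  exact absurd (hσ hle) (not_le.mpr hij)

end Summit.ValiantsHypothesis.ValiantsHypothesis.Theorems.GrenetZeon.HalfSpeed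

end
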